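import Literature.NumberTheory.Automorphic.NewformAdelisationLift
import HarnessLib

/-!
# Adelisation of classical modular forms, III: the descent `φ ↦ f_φ` and the function-level
bijection `f ↔ φ_f` (Gelbart 1997, Prop. 2.5, first step; Gelbart 1975, §3.A)

Topic `NumberTheory/Automorphic`; continues `NewformAdelisation` (the archimedean lift `archLift`,
`GL₂(𝔸_ℚ) = GL₂(ℚ)(GL₂(ℝ)⁺ × K₁(N))`, `GL₂(ℚ) ∩ (GL₂(ℝ)⁺ × K₁(N)) = Γ₁(N)`) and
`NewformAdelisationLift` (the adelic lift `φ_f = adelicLiftFun N k f` of `f ∈ M_k(Γ₁(N))` and its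
invariance properties).  Those two files formalise the direction `f ↦ φ_f` of the dictionary
between classical forms and functions on `GL₂(ℚ) \ GL₂(𝔸_ℚ)`; this file formalises the
**converse direction** and proves that the two are **mutually inverse**, i.e. the first step of
the proof of Gelbart's dictionary (S. Gelbart, *Three lectures …* (1997), Prop. 2.5 and its
sketch of proof, p. 170, (2.5.4): "this map `f ↦ φ_f` is an isomorphism from `S_k(Γ_0(N), ψ)` to
the space of … `φ` on `GL₂(𝔸)` such that (i) `φ(γ g) = φ(g)` …; (ii) `φ(g k) = χ_ψ(k) φ(g)` …;
(iii) `φ(g r(θ)) = e^{-ikθ} φ(g)` …; (iv) `φ(z g) = χ_ψ(z) φ(g)` …; (v) `X · φ = 0`; (vi) moderate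
growth; (vii) cuspidal"), at the **algebraic level (i)–(iv)** and for the level structure
`K₁(N)` with trivial character used by the tree (`Rat.plusLevelOne`, `adelicLiftFun`; Bump (1997),
(6.3) with `λ = 1`).  The analytic conditions (v)–(vii) (holomorphy, growth, cuspidality) are not
treated here.

Everything is proved; there is no named fact.  Contents:

* **Archimedean descent.** `archDescent k F τ = F(g_τ) (√y)^{-k}` with `g_τ = (y x; 0 1)`
  (`upperHalfPlaneToGL`), the inverse of `archLift`: `archDescent_archLift` (`f ↦ φ_f ↦ f` is the
  identity, for every `f : ℍ → ℂ`), the weight-`k` condition `HasArchWeight k F` at `∞`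
  ((iii)–(iv): `F(g κ) = F(g) j(κ, i)^{-k} (√det κ)^k` for `κ` in the stabiliser `ℝ_{>0} SO(2)`
  of `i`; a predicate, satisfied by every `archLift k f`, `hasArchWeight_archLift`),
  `archLift_archDescent` (`F ↦ f_F ↦ F` is the identity on `GL₂(ℝ)⁺` for `F` of weight `k`) and
  `slash_archDescent` (left invariance of `F` under `γ`, `det γ = 1`, descends to
  `f_F ∣[k] γ = f_F`).
* **The stabiliser of `i`.** `rotGL θ = r(θ) ∈ SO(2)`; `HasArchWeight k F` is *equivalent* to
  (iii) `F(g r(θ)) = F(g) e^{-ikθ}` and (iv) `F(g (r · 1)) = F(g)`, `r > 0`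
  (`hasArchWeight_iff`, through `exists_eq_realScalarGL_mul_rotGL`: an element of `GL₂(ℝ)⁺`
  fixing `i` is `r · r(θ)`).
* **Archimedean and finite parts.** `g = (g_∞, 1)(1, g_f)` (`Rat.ofRealGL_archGL_mul_ofFinite_sndHom`),
  the two factors commute (`Rat.ofRealGL_mul_ofFinite_comm`), and for `A ∈ Γ₁(N)` the diagonal
  `A_ℚ` is `(A_∞, 1)(1, A_f)` with `A_f ∈ K₁(N)` (`Rat.ofGlobal_mapGL_eq`,
  `Rat.sndHom_ofGlobal_mapGL_mem`).
* **Descent of adelic functions.** For `φ : GL₂(𝔸_ℚ) → ℂ` with (i) `φ(γ g) = φ(g)` (`γ ∈ GL₂(ℚ)`)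
  and (ii) `φ(g (1, h)) = φ(g)` (`h ∈ K₁(N)`), the archimedean part `F_φ(g_∞) = φ((g_∞, 1))` is
  left `Γ₁(N)`-invariant (`apply_ofRealGL_mapGL_mul`); with (iii)–(iv) it descends to a
  slash-invariant form `adelicDescent N k φ … : SlashInvariantForm (Gamma1 N) k`
  (`slash_archDescent_ofRealGL`).
* **The bijection.** `φ_f` satisfies (i) (`adelicLiftFun_ofGlobal_mul`, part II), (ii)
  (`adelicLiftFun_mul_ofFinite`) and (iii)–(iv) (`hasArchWeight_adelicLiftFun`); the descent of
  `φ_f` is `f` (`archDescent_adelicLiftFun`); and every `φ` with (i)–(iv) is the adelic lift of its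
  descent, `adelicLiftFun N k (adelicDescent N k φ …) = φ` (`adelicLiftFun_adelicDescent`).

This is infrastructure for the converse ("adelic to classical") direction of the dictionary,
needed for Gelbart 1997, Corollary of Prop. 2.5 (weight one) and Prop. 4.2
(`Literature.NumberTheory.Automorphic.exists_isNewform1_of_isPiOfArtinRep`, `StrongArtinGL2`):
a weight-`k` vector `φ` of level `K₁(N)` in a cuspidal automorphic representation `π ⊂ 𝒜₀`
(Borel–Jacquet functions on `GL₂(𝔸_ℚ)`) yields the classical form `f_φ` with `φ = φ_{f_φ}`.

## References

* S. Gelbart, *Three lectures on the modularity of `ρ̄_{E,3}` and the Langlands reciprocity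
  conjecture*, in: Modular Forms and Fermat's Last Theorem (1997), Prop. 2.5 and sketch of proof,
  (2.5.4), pp. 169–170. [Gelbart1997]
* S. Gelbart, *Automorphic forms on adele groups*, Ann. of Math. Stud. 83 (1975), §3.A,
  (3.1)–(3.5), Prop. 3.1. [Gelbart1975]
* D. Bump, *Automorphic forms and representations* (1997), §3.6, (6.1)–(6.3). [Bump1997]
-/
noncomputable section

open Matrix NumberField IsDedekindDomain UpperHalfPlane
open scoped MatrixGroups ModularForm NNReal

namespace Literature.NumberTheory.Automorphic

/-! ### The archimedean descent `F ↦ f_F`, inverse to `archLift` -/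

section ArchDescent

/-- `det (y x; 0 1) = y > 0`. [folklore] -/
theorem det_upperHalfPlaneToGL_pos (τ : ℍ) : 0 < (upperHalfPlaneToGL τ).det.val := by
  rw [det_upperHalfPlaneToGL]; exact τ.im_pos

/-- `j((y x; 0 1), i) = 0 · i + 1 = 1`. [folklore] -/
theorem denom_upperHalfPlaneToGL_I (τ : ℍ) :
    denom (upperHalfPlaneToGL τ) UpperHalfPlane.I = 1 := by
  simp only [UpperHalfPlane.denom, upperHalfPlaneToGL, Matrix.GeneralLinearGroup.val_mkOfDetNeZero,
    Matrix.of_apply, Matrix.cons_val', Matrix.cons_val_zero, Matrix.cons_val_one, Matrix.empty_val',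
    Matrix.cons_val_fin_one, Complex.ofReal_zero, zero_mul, Complex.ofReal_one, zero_add]

/-- For `det κ > 0` the automorphy factor is a cocycle without complex conjugation:
`j(g κ, z) = j(g, κ z) j(κ, z)` (Mathlib `UpperHalfPlane.denom_cocycle_σ` with `σ κ = id`).
[folklore] -/
theorem denom_mul_of_det_pos (g : GL (Fin 2) ℝ) {κ : GL (Fin 2) ℝ} (hκ : 0 < κ.det.val) (z : ℍ) :
    denom (g * κ) z = denom g ↑(κ • z) * denom κ z := by
  rw [denom_cocycle_σ, UpperHalfPlane.σ, if_pos hκ, ContinuousAlgEquiv.refl_apply]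

/-- `(√y)² = y` in `ℂ` for the imaginary part of a point of `ℍ`. [folklore] -/
theorem ofReal_im_eq_sqrt_sq (τ : ℍ) :
    ((τ.im : ℝ) : ℂ) = ((Real.sqrt τ.im : ℝ) : ℂ) ^ (2 : ℕ) := by
  rw [← Complex.ofReal_pow, Real.sq_sqrt τ.im_pos.le]

/-- **The archimedean lift at the standard section** `g_τ = (y x; 0 1)`:
`archLift k f g_τ = f(τ) (√y)^k` (`g_τ i = τ`, `det g_τ = y`, `j(g_τ, i) = 1`; Gelbart (1975),
(3.4): `φ_f(g_τ) = f(τ) y^{k/2}`). [cite: Gelbart1975, (3.4)] -/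
theorem archLift_upperHalfPlaneToGL (k : ℤ) (f : ℍ → ℂ) (τ : ℍ) :
    archLift k f (upperHalfPlaneToGL τ) = f τ * ((Real.sqrt τ.im : ℝ) : ℂ) ^ k := by
  have hs : ((Real.sqrt τ.im : ℝ) : ℂ) ≠ 0 := by
    exact_mod_cast (Real.sqrt_pos.2 τ.im_pos).ne'
  rw [archLift_apply_of_det_pos k f (det_upperHalfPlaneToGL_pos τ), upperHalfPlaneToGL_smul_I,
    denom_upperHalfPlaneToGL_I, _root_.one_zpow, mul_one, det_upperHalfPlaneToGL, ofReal_im_eq_sqrt_sq,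
    ← zpow_natCast, ← _root_.zpow_mul, mul_assoc, ← zpow_add₀ hs]
  congr 2
  push_cast
  ring

/-- **The archimedean descent** of a function `F` on `GL₂(ℝ)` in weight `k`: the function
`f_F(τ) = F(g_τ) (√y)^{-k}` on `ℍ`, `g_τ = (y x; 0 1)`, `τ = x + iy` — the inverse of the recipe
`φ_f(g_∞) = f(g_∞(i)) j(g_∞, i)^{-k}` of Gelbart 1997, (2.5.4) (Gelbart (1975), (3.4)) evaluated
on the section `τ ↦ g_τ` of `g ↦ g(i)`, `GL₂(ℝ)⁺ → ℍ`. [cite: Gelbart1997, (2.5.4)] -/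
def archDescent (k : ℤ) (F : GL (Fin 2) ℝ → ℂ) (τ : ℍ) : ℂ :=
  F (upperHalfPlaneToGL τ) * ((Real.sqrt τ.im : ℝ) : ℂ) ^ (-k)

/-- Unfolding `archDescent`. [folklore] -/
theorem archDescent_apply (k : ℤ) (F : GL (Fin 2) ℝ → ℂ) (τ : ℍ) :
    archDescent k F τ = F (upperHalfPlaneToGL τ) * ((Real.sqrt τ.im : ℝ) : ℂ) ^ (-k) :=
  rfl

/-- The descent only sees the values of `F` on the section `g_τ`: functions agreeing on
`GL₂(ℝ)⁺` have the same descent. [folklore] -/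
theorem archDescent_congr (k : ℤ) {F G : GL (Fin 2) ℝ → ℂ}
    (h : ∀ g : GL (Fin 2) ℝ, 0 < g.det.val → F g = G g) : archDescent k F = archDescent k G := by
  funext τ
  rw [archDescent_apply, archDescent_apply, h _ (det_upperHalfPlaneToGL_pos τ)]

/-- **`f ↦ φ_f ↦ f` is the identity**: the descent of the archimedean lift of any `f : ℍ → ℂ`
is `f` (`archLift k f g_τ = f(τ) (√y)^k`). This is the injectivity half of "the map `f ↦ φ_f` is
an isomorphism" (Gelbart 1997, sketch of proof of Prop. 2.5, p. 170).
[cite: Gelbart1997, Prop. 2.5 (sketch of proof, (2.5.4))] -/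
theorem archDescent_archLift (k : ℤ) (f : ℍ → ℂ) : archDescent k (archLift k f) = f := by
  funext τ
  have hs : ((Real.sqrt τ.im : ℝ) : ℂ) ≠ 0 := by
    exact_mod_cast (Real.sqrt_pos.2 τ.im_pos).ne'
  rw [archDescent_apply, archLift_upperHalfPlaneToGL, mul_assoc, ← zpow_add₀ hs, add_neg_cancel,
    zpow_zero, mul_one]

/-- **Weight `k` at the archimedean place** (Gelbart 1997, (2.5.4), conditions (iii)–(iv) at
`∞`: `φ(g r(θ)) = e^{-ikθ} φ(g)` for `r(θ) ∈ SO(2)` and `φ(z g) = φ(g)` for `z ∈ ℝ_{>0}`), as one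
condition on a function `F` on `GL₂(ℝ)⁺`: for `κ` in the stabiliser `ℝ_{>0} SO(2)` of `i` in
`GL₂(ℝ)⁺`, `F(g κ) = F(g) j(κ, i)^{-k} (√det κ)^k` (for `κ = r · r(θ)`: `j(κ, i) = r e^{iθ}`,
`√det κ = r`, so the factor is `e^{-ikθ}`). A predicate on `F` (explicit arguments), not a named
fact. [cite: Gelbart1997, (2.5.4) (iii)–(iv)] -/
def HasArchWeight (k : ℤ) (F : GL (Fin 2) ℝ → ℂ) : Prop :=
  ∀ g κ : GL (Fin 2) ℝ, 0 < g.det.val → 0 < κ.det.val → κ • UpperHalfPlane.I = UpperHalfPlane.I →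
    F (g * κ) = F g * (denom κ UpperHalfPlane.I ^ (-k) * ((Real.sqrt κ.det.val : ℝ) : ℂ) ^ k)

/-- **The archimedean lift has weight `k`** (Gelbart 1997, (2.5.4) (iii)–(iv); Gelbart (1975),
Prop. 3.1 (iii), (v)): `archLift k f (g κ) = archLift k f g · j(κ, i)^{-k} (√det κ)^k` for `κ`
fixing `i`, by the cocycle relation `j(g κ, i) = j(g, i) j(κ, i)` and `det(g κ) = det g det κ`.
[cite: Gelbart1997, (2.5.4) (iii)–(iv)] [cite: Gelbart1975, Prop. 3.1] -/
theorem hasArchWeight_archLift (k : ℤ) (f : ℍ → ℂ) : HasArchWeight k (archLift k f) := by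
  intro g κ hg hκ hκI
  have hgκ : 0 < (g * κ).det.val := by rw [map_mul, Units.val_mul]; positivity
  have hsκ : ((Real.sqrt κ.det.val : ℝ) : ℂ) ≠ 0 := by exact_mod_cast (Real.sqrt_pos.2 hκ).ne'
  have hdetκ : ((κ.det.val : ℝ) : ℂ) = ((Real.sqrt κ.det.val : ℝ) : ℂ) ^ (2 : ℕ) := by
    rw [← Complex.ofReal_pow, Real.sq_sqrt hκ.le]
  have key : (((Real.sqrt κ.det.val : ℝ) : ℂ) ^ (2 : ℕ)) ^ (k - 1) *
      ((Real.sqrt κ.det.val : ℝ) : ℂ) ^ (2 - k) = ((Real.sqrt κ.det.val : ℝ) : ℂ) ^ k := by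
    rw [← zpow_natCast, ← _root_.zpow_mul, ← zpow_add₀ hsκ]
    congr 1
    push_cast
    ring
  rw [archLift_apply_of_det_pos k f hgκ, archLift_apply_of_det_pos k f hg, mul_smul, hκI,
    denom_mul_of_det_pos g hκ, hκI, map_mul, Units.val_mul, Real.sqrt_mul hg.le,
    Complex.ofReal_mul, Complex.ofReal_mul, mul_zpow, mul_zpow, mul_zpow, hdetκ]
  linear_combination f (g • UpperHalfPlane.I) * ((g.det.val : ℝ) : ℂ) ^ (k - 1) *
    denom g UpperHalfPlane.I ^ (-k) * ((Real.sqrt g.det.val : ℝ) : ℂ) ^ (2 - k) *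
    denom κ UpperHalfPlane.I ^ (-k) * key

/-- **`F ↦ f_F ↦ φ_{f_F}` is the identity on functions of weight `k`**: if `F` has weight `k` at
the archimedean place, the archimedean lift of its descent is `F` on `GL₂(ℝ)⁺`. Write
`g = g_τ κ` with `τ = g(i)` and `κ = g_τ⁻¹ g` in the stabiliser of `i`; then
`F(g) = F(g_τ) j(κ, i)^{-k} (√det κ)^k`, and the lift of `f_F` at `g` unwinds to the same
expression (`j(g, i) = j(κ, i)`, `det g = y det κ`). This is the surjectivity half of "the map
`f ↦ φ_f` is an isomorphism onto the functions satisfying (i)–(iv)" (Gelbart 1997, sketch of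
proof of Prop. 2.5, p. 170), at the archimedean place.
[cite: Gelbart1997, Prop. 2.5 (sketch of proof, (2.5.4))] -/
theorem archLift_archDescent {k : ℤ} {F : GL (Fin 2) ℝ → ℂ} (hF : HasArchWeight k F)
    {g : GL (Fin 2) ℝ} (hg : 0 < g.det.val) : archLift k (archDescent k F) g = F g := by
  set τ : ℍ := g • UpperHalfPlane.I with hτ
  set κ : GL (Fin 2) ℝ := (upperHalfPlaneToGL τ)⁻¹ * g with hκdef
  have e : g = upperHalfPlaneToGL τ * κ := by rw [hκdef, mul_inv_cancel_left]
  have hτpos := det_upperHalfPlaneToGL_pos τ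
  have hdet : g.det.val = τ.im * κ.det.val := by
    conv_lhs => rw [e, map_mul, Units.val_mul, det_upperHalfPlaneToGL]
  have hκ : 0 < κ.det.val := by
    have h : 0 < τ.im * κ.det.val := hdet ▸ hg
    exact pos_of_mul_pos_right h τ.im_pos.le
  have hκI : κ • UpperHalfPlane.I = UpperHalfPlane.I := by
    have h1 : upperHalfPlaneToGL τ • κ • UpperHalfPlane.I = upperHalfPlaneToGL τ • UpperHalfPlane.I := by
      rw [← mul_smul, ← e, upperHalfPlaneToGL_smul_I]
    exact smul_left_cancel _ h1
  have hden : denom g UpperHalfPlane.I = denom κ UpperHalfPlane.I := by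
    conv_lhs => rw [e, denom_mul_of_det_pos _ hκ, hκI, denom_upperHalfPlaneToGL_I, one_mul]
  -- abbreviations for the two square roots
  have hsτ : ((Real.sqrt τ.im : ℝ) : ℂ) ≠ 0 := by exact_mod_cast (Real.sqrt_pos.2 τ.im_pos).ne'
  have hsκ : ((Real.sqrt κ.det.val : ℝ) : ℂ) ≠ 0 := by exact_mod_cast (Real.sqrt_pos.2 hκ).ne'
  have hsg : Real.sqrt g.det.val = Real.sqrt τ.im * Real.sqrt κ.det.val := by
    rw [hdet, Real.sqrt_mul τ.im_pos.le]
  have hdetC : ((g.det.val : ℝ) : ℂ) =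
      (((Real.sqrt τ.im : ℝ) : ℂ) * ((Real.sqrt κ.det.val : ℝ) : ℂ)) ^ (2 : ℕ) := by
    rw [hdet, Complex.ofReal_mul, mul_pow, ← Complex.ofReal_pow, ← Complex.ofReal_pow,
      Real.sq_sqrt τ.im_pos.le, Real.sq_sqrt hκ.le]
  have key : ((Real.sqrt τ.im : ℝ) : ℂ) ^ (-k) *
      ((((Real.sqrt τ.im : ℝ) : ℂ) * ((Real.sqrt κ.det.val : ℝ) : ℂ)) ^ (2 : ℕ)) ^ (k - 1) *
      (((Real.sqrt τ.im : ℝ) : ℂ) * ((Real.sqrt κ.det.val : ℝ) : ℂ)) ^ (2 - k) =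
      ((Real.sqrt κ.det.val : ℝ) : ℂ) ^ k := by
    have hu : ((Real.sqrt τ.im : ℝ) : ℂ) * ((Real.sqrt κ.det.val : ℝ) : ℂ) ≠ 0 := mul_ne_zero hsτ hsκ
    rw [← zpow_natCast, ← _root_.zpow_mul, mul_assoc, ← zpow_add₀ hu,
      show ((2 : ℕ) : ℤ) * (k - 1) + (2 - k) = k by push_cast; ring, mul_zpow, ← mul_assoc,
      ← zpow_add₀ hsτ, neg_add_cancel, zpow_zero, one_mul]
  have hFg : F g = F (upperHalfPlaneToGL τ) *
      (denom κ UpperHalfPlane.I ^ (-k) * ((Real.sqrt κ.det.val : ℝ) : ℂ) ^ k) := by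
    conv_lhs => rw [e]
    exact hF _ _ hτpos hκ hκI
  rw [archLift_apply_of_det_pos k _ hg, archDescent_apply, ← hτ, hden, hsg, Complex.ofReal_mul, hdetC,
    hFg]
  linear_combination F (upperHalfPlaneToGL τ) * denom κ UpperHalfPlane.I ^ (-k) * key

/-- Slashing commutes with the archimedean lift for `|det γ| = 1`:
`archLift k (f ∣[k] γ) g = archLift k f (γ g)` (`(f|γ)|g = f|(γ g)`, `|det (γ g)| = |det g|`).
[folklore] -/
theorem archLift_slash (k : ℤ) (f : ℍ → ℂ) {γ : GL (Fin 2) ℝ} (hγ : |γ.det.val| = 1)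
    (g : GL (Fin 2) ℝ) : archLift k (f ∣[k] γ) g = archLift k f (γ * g) := by
  rw [archLift_apply, archLift_apply, SlashAction.slash_mul, map_mul, Units.val_mul, abs_mul, hγ,
    one_mul]

/-- **Left invariance descends to slash invariance** (Gelbart 1997, (2.5.4) (i) at `∞`; Gelbart
(1975), (3.5)): if `F` has weight `k` at the archimedean place and `F(γ g) = F(g)` on `GL₂(ℝ)⁺`
for a `γ` of determinant `1`, then `f_F ∣[k] γ = f_F`. Proof: `f_F ∣[k] γ` and `f_F` have the
same archimedean lift on `GL₂(ℝ)⁺` (`archLift_slash`, `archLift_archDescent` and the invariance),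
and a function on `ℍ` is recovered from its lift (`archDescent_archLift`).
[cite: Gelbart1997, (2.5.4) (i)] [cite: Gelbart1975, (3.5)] -/
theorem slash_archDescent {k : ℤ} {F : GL (Fin 2) ℝ → ℂ} (hF : HasArchWeight k F)
    {γ : GL (Fin 2) ℝ} (hγ : γ.det.val = 1)
    (hinv : ∀ g : GL (Fin 2) ℝ, 0 < g.det.val → F (γ * g) = F g) :
    archDescent k F ∣[k] γ = archDescent k F := by
  have hγ' : |γ.det.val| = 1 := by rw [hγ, abs_one]
  rw [← archDescent_archLift k (archDescent k F ∣[k] γ)]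
  refine archDescent_congr k fun g hg => ?_
  have hg' : 0 < (γ * g).det.val := by rw [map_mul, Units.val_mul, hγ, one_mul]; exact hg
  rw [archLift_slash k _ hγ', archLift_archDescent hF hg', hinv g hg]

end ArchDescent

/-! ### The stabiliser `ℝ_{>0} SO(2)` of `i`: weight `k` in terms of rotations and scalars -/

section Rotation

/-- The rotation `r(θ) = (cos θ, -sin θ; sin θ, cos θ) ∈ SO(2) ≤ GL₂(ℝ)` of Gelbart 1997,
(2.5.4) (iii). [cite: Gelbart1997, (2.5.4) (iii)] -/
def rotGL (θ : ℝ) : GL (Fin 2) ℝ :=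
  Matrix.GeneralLinearGroup.mkOfDetNeZero !![Real.cos θ, -Real.sin θ; Real.sin θ, Real.cos θ] (by
    rw [Matrix.det_fin_two_of]
    have h : Real.cos θ * Real.cos θ - -Real.sin θ * Real.sin θ = 1 := by
      linear_combination Real.cos_sq_add_sin_sq θ
    rw [h]
    exact one_ne_zero)

/-- Entries of `r(θ)`. [folklore] -/
theorem rotGL_apply_zero_zero (θ : ℝ) : (rotGL θ : Matrix (Fin 2) (Fin 2) ℝ) 0 0 = Real.cos θ := rfl

/-- Entries of `r(θ)`. [folklore] -/
theorem rotGL_apply_zero_one (θ : ℝ) : (rotGL θ : Matrix (Fin 2) (Fin 2) ℝ) 0 1 = -Real.sin θ := rfl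

/-- Entries of `r(θ)`. [folklore] -/
theorem rotGL_apply_one_zero (θ : ℝ) : (rotGL θ : Matrix (Fin 2) (Fin 2) ℝ) 1 0 = Real.sin θ := rfl

/-- Entries of `r(θ)`. [folklore] -/
theorem rotGL_apply_one_one (θ : ℝ) : (rotGL θ : Matrix (Fin 2) (Fin 2) ℝ) 1 1 = Real.cos θ := rfl

/-- `det r(θ) = cos² θ + sin² θ = 1`. [folklore] -/
theorem det_rotGL (θ : ℝ) : (rotGL θ).det.val = 1 := by
  rw [Matrix.GeneralLinearGroup.val_det_apply, Matrix.det_fin_two, rotGL_apply_zero_zero,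
    rotGL_apply_zero_one, rotGL_apply_one_zero, rotGL_apply_one_one]
  linear_combination Real.cos_sq_add_sin_sq θ

/-- `det r(θ) > 0`. [folklore] -/
theorem det_rotGL_pos (θ : ℝ) : 0 < (rotGL θ).det.val := by
  rw [det_rotGL]; exact one_pos

/-- `j(r(θ), i) = sin θ · i + cos θ = e^{iθ}`. [folklore] -/
theorem denom_rotGL_I (θ : ℝ) : denom (rotGL θ) UpperHalfPlane.I = Complex.exp (θ * Complex.I) := by
  rw [Complex.exp_mul_I, UpperHalfPlane.denom]
  change ((rotGL θ : Matrix (Fin 2) (Fin 2) ℝ) 1 0 : ℂ) * (UpperHalfPlane.I : ℂ) +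
    ((rotGL θ : Matrix (Fin 2) (Fin 2) ℝ) 1 1 : ℂ) = _
  rw [rotGL_apply_one_zero, rotGL_apply_one_one, UpperHalfPlane.coe_I]
  push_cast
  ring

/-- `r(θ)` fixes `i`: `(cos θ i - sin θ)/(sin θ i + cos θ) = i`. [folklore] -/
theorem rotGL_smul_I (θ : ℝ) : rotGL θ • UpperHalfPlane.I = UpperHalfPlane.I := by
  apply UpperHalfPlane.ext
  rw [UpperHalfPlane.coe_smul_of_det_pos (det_rotGL_pos θ), div_eq_iff (UpperHalfPlane.denom_ne_zero _ _),
    UpperHalfPlane.num, UpperHalfPlane.denom]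
  change ((rotGL θ : Matrix (Fin 2) (Fin 2) ℝ) 0 0 : ℂ) * (UpperHalfPlane.I : ℂ) +
      ((rotGL θ : Matrix (Fin 2) (Fin 2) ℝ) 0 1 : ℂ) =
    (UpperHalfPlane.I : ℂ) * (((rotGL θ : Matrix (Fin 2) (Fin 2) ℝ) 1 0 : ℂ) * (UpperHalfPlane.I : ℂ) +
      ((rotGL θ : Matrix (Fin 2) (Fin 2) ℝ) 1 1 : ℂ))
  rw [rotGL_apply_zero_zero, rotGL_apply_zero_one, rotGL_apply_one_zero, rotGL_apply_one_one,
    UpperHalfPlane.coe_I]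
  push_cast
  linear_combination (-Complex.sin (θ : ℂ)) * Complex.I_sq

/-- `j(r · 1, i) = r`. [folklore] -/
theorem denom_realScalarGL_I (r : ℝ) (hr : 0 < r) : denom (realScalarGL r hr) UpperHalfPlane.I = r := by
  rw [UpperHalfPlane.denom]
  change ((realScalarGL r hr : Matrix (Fin 2) (Fin 2) ℝ) 1 0 : ℂ) * (UpperHalfPlane.I : ℂ) +
    ((realScalarGL r hr : Matrix (Fin 2) (Fin 2) ℝ) 1 1 : ℂ) = _
  rw [realScalarGL_apply, realScalarGL_apply, if_neg (by decide), if_pos rfl, Complex.ofReal_zero,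
    zero_mul, zero_add]

/-- The positive scalars fix `i`. [folklore] -/
theorem realScalarGL_smul_I (r : ℝ) (hr : 0 < r) : realScalarGL r hr • UpperHalfPlane.I = UpperHalfPlane.I := by
  have h := realScalarGL_mul_smul r hr (g := 1) (by rw [map_one, Units.val_one]; exact one_pos)
    UpperHalfPlane.I
  rwa [mul_one, one_smul] at h

/-- **Condition (iii) from weight `k`**: `F(g r(θ)) = F(g) e^{-ikθ}` (Gelbart 1997, (2.5.4) (iii)).
[cite: Gelbart1997, (2.5.4) (iii)] -/
theorem HasArchWeight.mul_rotGL {k : ℤ} {F : GL (Fin 2) ℝ → ℂ} (hF : HasArchWeight k F)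
    {g : GL (Fin 2) ℝ} (hg : 0 < g.det.val) (θ : ℝ) :
    F (g * rotGL θ) = F g * Complex.exp (θ * Complex.I) ^ (-k) := by
  rw [hF g (rotGL θ) hg (det_rotGL_pos θ) (rotGL_smul_I θ), denom_rotGL_I, det_rotGL, Real.sqrt_one,
    Complex.ofReal_one, _root_.one_zpow, mul_one]

/-- **Condition (iv) from weight `k`**: `F(g (r · 1)) = F(g)` for `r > 0` (Gelbart 1997, (2.5.4)
(iv) with central character trivial on `ℝ_{>0}`, the convention of `archLift_realScalarGL_mul`).
[cite: Gelbart1997, (2.5.4) (iv)] -/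
theorem HasArchWeight.mul_realScalarGL {k : ℤ} {F : GL (Fin 2) ℝ → ℂ} (hF : HasArchWeight k F)
    {g : GL (Fin 2) ℝ} (hg : 0 < g.det.val) {r : ℝ} (hr : 0 < r) :
    F (g * realScalarGL r hr) = F g := by
  have hr' : ((r : ℝ) : ℂ) ≠ 0 := by exact_mod_cast hr.ne'
  have hdet : 0 < (realScalarGL r hr).det.val := by rw [det_realScalarGL]; positivity
  rw [hF g _ hg hdet (realScalarGL_smul_I r hr), denom_realScalarGL_I, det_realScalarGL,
    Real.sqrt_sq hr.le, ← zpow_add₀ hr', neg_add_cancel, zpow_zero, mul_one]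

/-- **The stabiliser of `i` in `GL₂(ℝ)⁺` is `ℝ_{>0} SO(2)`**: `κ i = i`, `det κ > 0` force
`κ = (a, -c; c, a) = r · r(θ)` with `r = √(a² + c²)`, `θ = arg(a + ci)` (Gelbart 1997, proof
of Prop. 2.5: `GL₂⁺(ℝ)/ℝ_{>0} SO(2) = ℍ`). [folklore] -/
theorem exists_eq_realScalarGL_mul_rotGL {κ : GL (Fin 2) ℝ} (hκ : 0 < κ.det.val)
    (hκI : κ • UpperHalfPlane.I = UpperHalfPlane.I) :
    ∃ (r : ℝ) (hr : 0 < r) (θ : ℝ), κ = realScalarGL r hr * rotGL θ := by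
  have hcoe : ((κ • UpperHalfPlane.I : ℍ) : ℂ) = (UpperHalfPlane.I : ℂ) := by rw [hκI]
  rw [UpperHalfPlane.coe_smul_of_det_pos hκ, div_eq_iff (UpperHalfPlane.denom_ne_zero _ _),
    UpperHalfPlane.num, UpperHalfPlane.denom, UpperHalfPlane.coe_I] at hcoe
  change ((κ : Matrix (Fin 2) (Fin 2) ℝ) 0 0 : ℂ) * Complex.I + ((κ : Matrix (Fin 2) (Fin 2) ℝ) 0 1 : ℂ) =
    Complex.I * ((((κ : Matrix (Fin 2) (Fin 2) ℝ) 1 0 : ℂ)) * Complex.I +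
      ((κ : Matrix (Fin 2) (Fin 2) ℝ) 1 1 : ℂ)) at hcoe
  have hre : (κ : Matrix (Fin 2) (Fin 2) ℝ) 0 1 = -(κ : Matrix (Fin 2) (Fin 2) ℝ) 1 0 := by
    have h := congrArg Complex.re hcoe
    simp only [Complex.add_re, Complex.mul_re, Complex.ofReal_re, Complex.ofReal_im, Complex.I_re,
      Complex.I_im, Complex.add_im, Complex.mul_im] at h
    linarith
  have him : (κ : Matrix (Fin 2) (Fin 2) ℝ) 0 0 = (κ : Matrix (Fin 2) (Fin 2) ℝ) 1 1 := by
    have h := congrArg Complex.im hcoe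
    simp only [Complex.add_re, Complex.mul_re, Complex.ofReal_re, Complex.ofReal_im, Complex.I_re,
      Complex.I_im, Complex.add_im, Complex.mul_im] at h
    linarith
  set a := (κ : Matrix (Fin 2) (Fin 2) ℝ) 1 1 with ha
  set c := (κ : Matrix (Fin 2) (Fin 2) ℝ) 1 0 with hc
  set z : ℂ := ⟨a, c⟩ with hz
  have hz0 : z ≠ 0 := by
    intro h0
    have ha0 : a = 0 := congrArg Complex.re h0
    have hc0 : c = 0 := congrArg Complex.im h0
    have : κ.det.val = 0 := by
      rw [Matrix.GeneralLinearGroup.val_det_apply, Matrix.det_fin_two, him, hre, ha0, hc0]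
      ring
    exact hκ.ne' this
  refine ⟨‖z‖, norm_pos_iff.2 hz0, Complex.arg z, ?_⟩
  have hcos : ‖z‖ * Real.cos (Complex.arg z) = a := Complex.norm_mul_cos_arg z
  have hsin : ‖z‖ * Real.sin (Complex.arg z) = c := Complex.norm_mul_sin_arg z
  ext i j
  rw [realScalarGL_mul_apply]
  fin_cases i <;> fin_cases j
  · change (κ : Matrix (Fin 2) (Fin 2) ℝ) 0 0 = ‖z‖ * (rotGL (Complex.arg z) : Matrix (Fin 2) (Fin 2) ℝ) 0 0
    rw [rotGL_apply_zero_zero, hcos, him]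
  · change (κ : Matrix (Fin 2) (Fin 2) ℝ) 0 1 = ‖z‖ * (rotGL (Complex.arg z) : Matrix (Fin 2) (Fin 2) ℝ) 0 1
    rw [rotGL_apply_zero_one, mul_neg, hsin, hre]
  · change (κ : Matrix (Fin 2) (Fin 2) ℝ) 1 0 = ‖z‖ * (rotGL (Complex.arg z) : Matrix (Fin 2) (Fin 2) ℝ) 1 0
    rw [rotGL_apply_one_zero, hsin]
  · change (κ : Matrix (Fin 2) (Fin 2) ℝ) 1 1 = ‖z‖ * (rotGL (Complex.arg z) : Matrix (Fin 2) (Fin 2) ℝ) 1 1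
    rw [rotGL_apply_one_one, hcos]

/-- **Weight `k` from conditions (iii) and (iv)** (Gelbart 1997, (2.5.4)): if
`F(g r(θ)) = F(g) e^{-ikθ}` and `F(g (r · 1)) = F(g)` (`r > 0`) on `GL₂(ℝ)⁺`, then `F` has
weight `k` in the sense of `HasArchWeight` (the stabiliser of `i` being `ℝ_{>0} SO(2)`,
`exists_eq_realScalarGL_mul_rotGL`).  With `HasArchWeight.mul_rotGL` and
`HasArchWeight.mul_realScalarGL` this identifies `HasArchWeight k` with (iii)–(iv).
[cite: Gelbart1997, (2.5.4) (iii)–(iv)] -/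
theorem hasArchWeight_of_rotGL_of_realScalarGL {k : ℤ} {F : GL (Fin 2) ℝ → ℂ}
    (hrot : ∀ (g : GL (Fin 2) ℝ) (θ : ℝ), 0 < g.det.val →
      F (g * rotGL θ) = F g * Complex.exp (θ * Complex.I) ^ (-k))
    (hsc : ∀ (g : GL (Fin 2) ℝ) (r : ℝ) (hr : 0 < r), 0 < g.det.val → F (g * realScalarGL r hr) = F g) :
    HasArchWeight k F := by
  intro g κ hg hκ hκI
  obtain ⟨r, hr, θ, rfl⟩ := exists_eq_realScalarGL_mul_rotGL hκ hκI
  have hr' : ((r : ℝ) : ℂ) ≠ 0 := by exact_mod_cast hr.ne'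
  have hgr : 0 < (g * realScalarGL r hr).det.val := by
    rw [map_mul, Units.val_mul, det_realScalarGL]; positivity
  rw [← mul_assoc, hrot _ θ hgr, hsc g r hr hg, denom_realScalarGL_mul, denom_rotGL_I, map_mul,
    Units.val_mul, det_realScalarGL, det_rotGL, mul_one, Real.sqrt_sq hr.le, mul_zpow,
    mul_comm (((r : ℝ) : ℂ) ^ (-k)), mul_assoc, ← zpow_add₀ hr', neg_add_cancel, zpow_zero, mul_one]

/-- **`HasArchWeight k` is exactly (iii) + (iv)** of Gelbart 1997, (2.5.4), on `GL₂(ℝ)⁺`.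
[cite: Gelbart1997, (2.5.4) (iii)–(iv)] -/
theorem hasArchWeight_iff {k : ℤ} {F : GL (Fin 2) ℝ → ℂ} :
    HasArchWeight k F ↔
      (∀ (g : GL (Fin 2) ℝ) (θ : ℝ), 0 < g.det.val →
          F (g * rotGL θ) = F g * Complex.exp (θ * Complex.I) ^ (-k)) ∧
        ∀ (g : GL (Fin 2) ℝ) (r : ℝ) (hr : 0 < r), 0 < g.det.val → F (g * realScalarGL r hr) = F g :=
  ⟨fun h => ⟨fun _ θ hg => h.mul_rotGL hg θ, fun _ _ hr hg => h.mul_realScalarGL hg hr⟩,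
    fun h => hasArchWeight_of_rotGL_of_realScalarGL h.1 h.2⟩

end Rotation

/-! ### `GL₂(𝔸_ℚ) = GL₂(ℝ) · GL₂(𝔸_ℚ^∞)`: archimedean and finite parts -/

section ArchFiniteParts

/-- The archimedean part of `(g_∞, 1)`, in `GL_n(𝔸_{ℚ,∞})`. [folklore] -/
theorem Rat.fstHom_ofRealGL (n : ℕ) (g : GL (Fin n) ℝ) :
    GLn.fstHom n ℚ (Rat.ofRealGL n g) =
      Matrix.GeneralLinearGroup.map Rat.infiniteAdeleRingEquivReal.symm.toRingHom g := by
  rw [Rat.ofRealGL, MonoidHom.comp_apply, GLn.fstHom_ofArch]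

/-- `𝔸_{ℚ,∞} = ℝ`: transporting the archimedean part `g_∞ ∈ GL_n(ℝ)` back to `GL_n(𝔸_{ℚ,∞})`
gives the first projection. [folklore] -/
theorem Rat.map_symm_archGL (n : ℕ) (g : GL (Fin n) (AdeleRing (𝓞 ℚ) ℚ)) :
    Matrix.GeneralLinearGroup.map Rat.infiniteAdeleRingEquivReal.symm.toRingHom (Rat.archGL n g) =
      GLn.fstHom n ℚ g := by
  ext i j
  rw [Matrix.GeneralLinearGroup.map_apply, Rat.archGL_apply, Matrix.GeneralLinearGroup.map_apply]
  exact Rat.infiniteAdeleRingEquivReal.symm_apply_apply _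

/-- **`g = (g_∞, 1) · (1, g_f)`** in `GL_n(𝔸_ℚ) = GL_n(ℝ × 𝔸_ℚ^∞)` (Gelbart (1975), §3.A:
`G_𝔸 = G_∞ × G_{𝔸_f}`; Gelbart 1997, (2.5.4): `g = γ g_∞ k₀`). [cite: Gelbart1975, §3.A] -/
theorem Rat.ofRealGL_archGL_mul_ofFinite_sndHom (n : ℕ) (g : GL (Fin n) (AdeleRing (𝓞 ℚ) ℚ)) :
    Rat.ofRealGL n (Rat.archGL n g) * GLn.ofFinite n ℚ (GLn.sndHom n ℚ g) = g := by
  refine GLn.ext_of_fstHom_of_sndHom ?_ ?_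
  · rw [map_mul, GLn.fstHom_ofFinite, mul_one, Rat.fstHom_ofRealGL, Rat.map_symm_archGL]
  · rw [map_mul, GLn.sndHom_ofFinite, Rat.sndHom_ofRealGL, one_mul]

/-- The archimedean and finite factors commute: `(g_∞, 1) (1, h) = (1, h) (g_∞, 1)`. [folklore] -/
theorem Rat.ofRealGL_mul_ofFinite_comm (n : ℕ) (x : GL (Fin n) ℝ)
    (h : GL (Fin n) (FiniteAdeleRing (𝓞 ℚ) ℚ)) :
    Rat.ofRealGL n x * GLn.ofFinite n ℚ h = GLn.ofFinite n ℚ h * Rat.ofRealGL n x := by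
  refine GLn.ext_of_fstHom_of_sndHom ?_ ?_
  · rw [map_mul, map_mul, GLn.fstHom_ofFinite, mul_one, one_mul]
  · rw [map_mul, map_mul, GLn.sndHom_ofFinite, Rat.sndHom_ofRealGL, mul_one, one_mul]

/-- The diagonal image of `A ∈ SL₂(ℤ)` is `(A_∞, 1) (1, A_f)` with `A_∞ = mapGL ℝ A`.
[cite: Gelbart1975, (3.5)] -/
theorem Rat.ofGlobal_mapGL_eq (A : SL(2, ℤ)) :
    GLn.ofGlobal 2 ℚ (Matrix.SpecialLinearGroup.mapGL ℚ A) =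
      Rat.ofRealGL 2 (Matrix.SpecialLinearGroup.mapGL ℝ A) *
        GLn.ofFinite 2 ℚ (GLn.sndHom 2 ℚ (GLn.ofGlobal 2 ℚ (Matrix.SpecialLinearGroup.mapGL ℚ A))) := by
  conv_lhs => rw [← Rat.ofRealGL_archGL_mul_ofFinite_sndHom 2 (GLn.ofGlobal 2 ℚ _)]
  rw [Rat.archGL_ofGlobal, Rat.map_castHom_mapGL]

/-- For `A ∈ Γ₁(N)` the finite part `A_f` lies in `K₁(N)` (`Rat.ofGlobal_mapGL_mem_plusLevelOne`).
[cite: Gelbart1975, (3.5)] -/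
theorem Rat.sndHom_ofGlobal_mapGL_mem {N : ℕ} [NeZero N] {A : SL(2, ℤ)}
    (hA : A ∈ CongruenceSubgroup.Gamma1 N) :
    GLn.sndHom 2 ℚ (GLn.ofGlobal 2 ℚ (Matrix.SpecialLinearGroup.mapGL ℚ A)) ∈
      gammaOneFiniteLevel ℚ (Ideal.span {(N : 𝓞 ℚ)}) :=
  (Rat.mem_plusLevelOne_iff.1 (Rat.ofGlobal_mapGL_mem_plusLevelOne hA)).2

/-- `det (mapGL ℝ A) = 1` for `A ∈ SL₂(ℤ)`. [folklore] -/
theorem Rat.det_mapGL_real (A : SL(2, ℤ)) :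
    (Matrix.SpecialLinearGroup.mapGL ℝ A : GL (Fin 2) ℝ).det.val = 1 := by
  rw [Matrix.GeneralLinearGroup.val_det_apply]
  change ((A : Matrix (Fin 2) (Fin 2) ℤ).map (Int.castRingHom ℝ)).det = 1
  rw [← RingHom.mapMatrix_apply, ← RingHom.map_det, A.det_coe, map_one]

end ArchFiniteParts

/-! ### The descent `φ ↦ f_φ` of left `GL₂(ℚ)`-invariant, right `K₁(N)`-invariant functions -/

section Descent

variable {N : ℕ} [NeZero N] {k : ℤ} {φ : GL (Fin 2) (AdeleRing (𝓞 ℚ) ℚ) → ℂ}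

/-- **The archimedean part of an adelic function of level `K₁(N)` is left `Γ₁(N)`-invariant**
(Gelbart 1997, (2.5.4) with (3.5): `G_ℚ ∩ G_∞⁺ K₁(N) = Γ₁(N)`; Gelbart (1975), (3.5)). If
`φ : GL₂(𝔸_ℚ) → ℂ` is left invariant under `GL₂(ℚ)` (condition (i)) and right invariant under
`{1} × K₁(N)` (condition (ii) with trivial character on `K₁(N)`), then
`F_φ(A g_∞) = F_φ(g_∞)` for `A ∈ Γ₁(N)`, where `F_φ(g_∞) = φ((g_∞, 1))`: indeed
`(A, 1) = A_ℚ · (1, A_f)⁻¹` with `A_ℚ ∈ GL₂(ℚ)` diagonal and `A_f ∈ K₁(N)`, and `(1, A_f⁻¹)`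
commutes with `(g_∞, 1)`. [cite: Gelbart1997, (2.5.4) (i)–(ii)] [cite: Gelbart1975, (3.5)] -/
theorem apply_ofRealGL_mapGL_mul
    (hleft : ∀ (γ : GL (Fin 2) ℚ) (g : GL (Fin 2) (AdeleRing (𝓞 ℚ) ℚ)), φ (GLn.ofGlobal 2 ℚ γ * g) = φ g)
    (hright : ∀ h ∈ gammaOneFiniteLevel ℚ (Ideal.span {(N : 𝓞 ℚ)}),
      ∀ g : GL (Fin 2) (AdeleRing (𝓞 ℚ) ℚ), φ (g * GLn.ofFinite 2 ℚ h) = φ g)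
    {A : SL(2, ℤ)} (hA : A ∈ CongruenceSubgroup.Gamma1 N) (g : GL (Fin 2) ℝ) :
    φ (Rat.ofRealGL 2 (Matrix.SpecialLinearGroup.mapGL ℝ A * g)) = φ (Rat.ofRealGL 2 g) := by
  set h := GLn.sndHom 2 ℚ (GLn.ofGlobal 2 ℚ (Matrix.SpecialLinearGroup.mapGL ℚ A)) with hh
  have hmem : h ∈ gammaOneFiniteLevel ℚ (Ideal.span {(N : 𝓞 ℚ)}) := Rat.sndHom_ofGlobal_mapGL_mem hA
  have e : Rat.ofRealGL 2 (Matrix.SpecialLinearGroup.mapGL ℝ A) =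
      GLn.ofGlobal 2 ℚ (Matrix.SpecialLinearGroup.mapGL ℚ A) * GLn.ofFinite 2 ℚ h⁻¹ := by
    rw [Rat.ofGlobal_mapGL_eq, ← hh, mul_assoc, ← map_mul, mul_inv_cancel, map_one, mul_one]
  rw [map_mul, e, mul_assoc, ← Rat.ofRealGL_mul_ofFinite_comm, hleft, hright _ (inv_mem hmem)]

/-- **Slash invariance of the descent** (Gelbart 1997, sketch of proof of Prop. 2.5, p. 170:
the function-level dictionary; Gelbart (1975), §3.A). If `φ` satisfies (i) left
`GL₂(ℚ)`-invariance, (ii) right `{1} × K₁(N)`-invariance and (iii)–(iv) weight `k` at the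
archimedean place (`HasArchWeight k F_φ`), then `f_φ = archDescent k F_φ` satisfies
`f_φ ∣[k] γ = f_φ` for every `γ` in the arithmetic subgroup `Γ₁(N) ≤ GL₂(ℝ)`.
[cite: Gelbart1997, Prop. 2.5 (sketch of proof, (2.5.4))] [cite: Gelbart1975, §3.A] -/
theorem slash_archDescent_ofRealGL
    (hleft : ∀ (γ : GL (Fin 2) ℚ) (g : GL (Fin 2) (AdeleRing (𝓞 ℚ) ℚ)), φ (GLn.ofGlobal 2 ℚ γ * g) = φ g)
    (hright : ∀ h ∈ gammaOneFiniteLevel ℚ (Ideal.span {(N : 𝓞 ℚ)}),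
      ∀ g : GL (Fin 2) (AdeleRing (𝓞 ℚ) ℚ), φ (g * GLn.ofFinite 2 ℚ h) = φ g)
    (hweight : HasArchWeight k fun x => φ (Rat.ofRealGL 2 x)) {γ : GL (Fin 2) ℝ}
    (hγ : γ ∈ ((CongruenceSubgroup.Gamma1 N : Subgroup SL(2, ℤ)) : Subgroup (GL (Fin 2) ℝ))) :
    archDescent k (fun x => φ (Rat.ofRealGL 2 x)) ∣[k] γ =
      archDescent k (fun x => φ (Rat.ofRealGL 2 x)) := by
  obtain ⟨A, hA, rfl⟩ := Subgroup.mem_map.1 hγ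
  exact slash_archDescent hweight (Rat.det_mapGL_real A) fun g _ =>
    apply_ofRealGL_mapGL_mul hleft hright hA g

variable (N k) in
/-- **The classical form `f_φ ∈ M_k(Γ₁(N))^{alg}` of an adelic function `φ`** (Gelbart 1997,
(2.5.4) read from right to left; Gelbart (1975), §3.A; Bump (1997), §3.6): for
`φ : GL₂(𝔸_ℚ) → ℂ` with (i) `φ(γ g) = φ(g)`, `γ ∈ GL₂(ℚ)`, (ii) `φ(g (1, h)) = φ(g)`, `h ∈ K₁(N)`,
and (iii)–(iv) weight `k` at `∞`, the function `f_φ(τ) = φ((g_τ, 1)) (√y)^{-k}` on `ℍ` is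
slash-invariant of weight `k` and level `Γ₁(N)` (`slash_archDescent_ofRealGL`), packaged as a
Mathlib `SlashInvariantForm`. (Holomorphy, the cusp conditions and growth — (v)–(vii) of
(2.5.4) — are not part of this algebraic statement.) [cite: Gelbart1997, (2.5.4)] -/
def adelicDescent (φ : GL (Fin 2) (AdeleRing (𝓞 ℚ) ℚ) → ℂ)
    (hleft : ∀ (γ : GL (Fin 2) ℚ) (g : GL (Fin 2) (AdeleRing (𝓞 ℚ) ℚ)), φ (GLn.ofGlobal 2 ℚ γ * g) = φ g)
    (hright : ∀ h ∈ gammaOneFiniteLevel ℚ (Ideal.span {(N : 𝓞 ℚ)}),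
      ∀ g : GL (Fin 2) (AdeleRing (𝓞 ℚ) ℚ), φ (g * GLn.ofFinite 2 ℚ h) = φ g)
    (hweight : HasArchWeight k fun x => φ (Rat.ofRealGL 2 x)) :
    SlashInvariantForm (CongruenceSubgroup.Gamma1 N) k where
  toFun := archDescent k fun x => φ (Rat.ofRealGL 2 x)
  slash_action_eq' _ hγ := slash_archDescent_ofRealGL hleft hright hweight hγ

/-- `f_φ(τ) = φ((g_τ, 1)) (√y)^{-k}` (definitional). [cite: Gelbart1997, (2.5.4)] -/
theorem adelicDescent_apply
    (hleft : ∀ (γ : GL (Fin 2) ℚ) (g : GL (Fin 2) (AdeleRing (𝓞 ℚ) ℚ)), φ (GLn.ofGlobal 2 ℚ γ * g) = φ g)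
    (hright : ∀ h ∈ gammaOneFiniteLevel ℚ (Ideal.span {(N : 𝓞 ℚ)}),
      ∀ g : GL (Fin 2) (AdeleRing (𝓞 ℚ) ℚ), φ (g * GLn.ofFinite 2 ℚ h) = φ g)
    (hweight : HasArchWeight k fun x => φ (Rat.ofRealGL 2 x)) (τ : ℍ) :
    adelicDescent N k φ hleft hright hweight τ =
      φ (Rat.ofRealGL 2 (upperHalfPlaneToGL τ)) * ((Real.sqrt τ.im : ℝ) : ℂ) ^ (-k) :=
  rfl

end Descent

/-! ### The function-level bijection `f ↔ φ_f` (Gelbart 1997, Prop. 2.5, first step) -/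

section Bijection

variable {N : ℕ} {k : ℤ} [NeZero N] {F : Type*} [FunLike F ℍ ℂ]
  [SlashInvariantFormClass F (CongruenceSubgroup.Gamma1 N) k] (f : F)

/-- **Condition (ii) for `φ_f` in factorised form**: `φ_f(g (1, h)) = φ_f(g)` for `h ∈ K₁(N)`
(`adelicLiftFun_mul_of_archGL_eq_one`; Gelbart (1975), Prop. 3.1 (ii)). [cite: Gelbart1975, Prop. 3.1] -/
theorem adelicLiftFun_mul_ofFinite {h : GL (Fin 2) (FiniteAdeleRing (𝓞 ℚ) ℚ)}
    (hh : h ∈ gammaOneFiniteLevel ℚ (Ideal.span {(N : 𝓞 ℚ)})) (g : GL (Fin 2) (AdeleRing (𝓞 ℚ) ℚ)) :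
    adelicLiftFun N k f (g * GLn.ofFinite 2 ℚ h) = adelicLiftFun N k f g :=
  adelicLiftFun_mul_of_archGL_eq_one f
    (by rw [Rat.archGL, MonoidHom.comp_apply, GLn.fstHom_ofFinite, map_one])
    (by rwa [GLn.sndHom_ofFinite]) g

/-- **Conditions (iii)–(iv) for `φ_f`**: the archimedean part `g_∞ ↦ φ_f((g_∞, 1)) = archLift k f g_∞`
of the adelic lift has weight `k` (`hasArchWeight_archLift`; Gelbart (1975), Prop. 3.1 (iii), (v)).
[cite: Gelbart1997, (2.5.4) (iii)–(iv)] [cite: Gelbart1975, Prop. 3.1] -/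
theorem hasArchWeight_adelicLiftFun :
    HasArchWeight k fun x => adelicLiftFun N k f (Rat.ofRealGL 2 x) := by
  intro g κ hg hκ hκI
  have hgκ : 0 < (g * κ).det.val := by rw [map_mul, Units.val_mul]; positivity
  dsimp only
  rw [adelicLiftFun_ofRealGL f hgκ, adelicLiftFun_ofRealGL f hg]
  exact hasArchWeight_archLift k f g κ hg hκ hκI

/-- **`f ↦ φ_f ↦ f_{φ_f} = f`**: the descent of the adelic lift of a slash-invariant `f` of level
`Γ₁(N)` is `f` (on `GL₂(ℝ)⁺ ⊆ GL₂(𝔸_ℚ)` the adelic lift is the archimedean lift,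
`adelicLiftFun_ofRealGL`, and `archDescent_archLift`). Injectivity of `f ↦ φ_f` (Gelbart 1997,
sketch of proof of Prop. 2.5, p. 170). [cite: Gelbart1997, Prop. 2.5 (sketch of proof, (2.5.4))] -/
theorem archDescent_adelicLiftFun :
    archDescent k (fun x => adelicLiftFun N k f (Rat.ofRealGL 2 x)) = ⇑f := by
  rw [archDescent_congr k (G := archLift k f) fun g hg => adelicLiftFun_ofRealGL f hg]
  exact archDescent_archLift k f

/-- **`φ ↦ f_φ ↦ φ_{f_φ} = φ`**: an adelic function `φ` with (i) left `GL₂(ℚ)`-invariance, (ii)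
right `{1} × K₁(N)`-invariance and (iii)–(iv) weight `k` at `∞` is the adelic lift of its
classical form `f_φ` — surjectivity of `f ↦ φ_f` onto the functions with (i)–(iv) (Gelbart 1997,
sketch of proof of Prop. 2.5, p. 170: "this map `f ↦ φ_f` is an isomorphism … to the space of …
`φ` on `GL₂(𝔸)` such that (i) … (iv) …", at the algebraic level; Gelbart (1975), Prop. 3.1;
Bump (1997), §3.6). Proof: write `g = γ h` with `γ ∈ GL₂(ℚ)`, `h ∈ GL₂(ℝ)⁺ × K₁(N)`
(`Rat.exists_ofGlobal_inv_mul_mem_plusLevelOne`); then `φ_{f_φ}(g) = archLift k f_φ (h_∞) =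
F_φ(h_∞) = φ((h_∞, 1)) = φ((h_∞, 1)(1, h_f)) = φ(h) = φ(g)`.
[cite: Gelbart1997, Prop. 2.5 (sketch of proof, (2.5.4))] [cite: Gelbart1975, Prop. 3.1] -/
theorem adelicLiftFun_adelicDescent {φ : GL (Fin 2) (AdeleRing (𝓞 ℚ) ℚ) → ℂ}
    (hleft : ∀ (γ : GL (Fin 2) ℚ) (g : GL (Fin 2) (AdeleRing (𝓞 ℚ) ℚ)), φ (GLn.ofGlobal 2 ℚ γ * g) = φ g)
    (hright : ∀ h ∈ gammaOneFiniteLevel ℚ (Ideal.span {(N : 𝓞 ℚ)}),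
      ∀ g : GL (Fin 2) (AdeleRing (𝓞 ℚ) ℚ), φ (g * GLn.ofFinite 2 ℚ h) = φ g)
    (hweight : HasArchWeight k fun x => φ (Rat.ofRealGL 2 x)) :
    adelicLiftFun N k (adelicDescent N k φ hleft hright hweight) = φ := by
  funext g
  obtain ⟨γ, hγ⟩ := Rat.exists_ofGlobal_inv_mul_mem_plusLevelOne (Ideal.span {(N : 𝓞 ℚ)}) g
  obtain ⟨hdet, hfin⟩ := Rat.mem_plusLevelOne_iff.1 hγ
  rw [adelicLiftFun_eq_archLift (adelicDescent N k φ hleft hright hweight) hγ]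
  change archLift k (archDescent k fun x => φ (Rat.ofRealGL 2 x)) _ = _
  rw [archLift_archDescent hweight hdet]
  conv_rhs => rw [← hleft γ⁻¹ g, map_inv,
    ← Rat.ofRealGL_archGL_mul_ofFinite_sndHom 2 ((GLn.ofGlobal 2 ℚ γ)⁻¹ * g), hright _ hfin]

end Bijection

end Literature.NumberTheory.Automorphic

end
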